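import Summits.QuantumFields.BalabanUV.T4Continuum.Spine.NE4.FadingFromRate

/-!
# Spine/NE4/FadingFromRateUnder — node U2's output from NE4 + regularity UNDER THE TARGETS' QUANTIFIER PREFIX: the two-radii window of
# `Spine/NE4/FadingFromRate.u2Output_of_smooth` DISCHARGED by choosing the run box (no smallness binder left)

Cell `pub-balaban-gaps` (YM blitz G2), seat `ne4`, generation 3; record `HOME/ne/NE4.md` §5 (R29), §8 item 4.  Sequel of `Spine/NE4/FadingFromRate`
(same seat): there node U2 closes from {NE4 = `ScaleShiftRate`, the C^{1,1} bound `CoordDerivLipschitz`, the uniform bound `|β| ≤ B`} + the AF binders,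
with the β-side hypotheses on a FIXED box `]0,γᵤ]` and the runs in `]0,γ]`, `γ ≤ γᵤ`, under the window `C₁(γᵤ)·((k₀+1)γ³ + 2γ∕b) ≤ (1−τ)∕2`.  Since the
left side is `O(γ)` for fixed `γᵤ, b, k₀`, the window HOLDS for every `γ ≤ γ₀` with the explicit
`γ₀ = min(γᵤ, 1, ((1−τ)∕2) ∕ ((C₁+1)·((k₀+1) + 2∕b)))` (§1), so node U2's output holds in the form the spine's targets ask —
`FiniteEpsData.UnderHypotheses Hβ (fun g₀ ↦ U2Output D g₀ (2c∕(1−τ)) τ)`: for every `γ ≤ γ₀`, every `g`, every sequence tuned to `g` within `]0,γ]`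
(§2 `u2Output_under_of_smooth`; compare g0's `Targets.u2Output_under`, which needs the window AT `γᵤ` as a binder).  Also the downstream faces with
no fading binder and no window binder: the continuum running coupling (`continuumRunning_under_of_smooth`) and, on each small box, tuned uniqueness
(`tunedUniqueBelow_of_smooth`, window kept — it is a statement at one radius).  §3, UPSTREAM: the whole node-U2 triple on the data from row NE5
(for every unpaired coupling) + the covariant read-out (R) + the regularity and uniform bounds on `D.βfun` — `u2Inputs_of_ne5_smooth`; row NE9 and
node U3's `FadingMemory` (both inputs of g0's `Targets.u2Inputs_of_u3`) are NOT inputs of node U2 any more.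

HONEST FRAMING: bookkeeping over hypothesis SHAPES on the abstract data `D : FiniteEpsData`; every β-side binder UNPRINTED except the TYPE of the
regularity clause ([Balaban1987RG1] p. 264, last coupling); NE4 NOT IN PRINT, NOT PROVED; spine PROVED 0∕9 unchanged; NOT the continuum limit on
ℝ⁴, NOT infinite volume, NOT a mass gap, NOT Clay.  HONEST DEPENDENCY: continuum YM on T⁴ ⇐ BetaPertH ∧ nine spine estimates (0∕9 proved);
BetaPertH ⇐ (D1) ∧ (D4) ∧ CAP+tail.  Reference (TYPES only): [Balaban1987RG1] = T. Bałaban, Commun. Math. Phys. **109** (1987) 249–301, Thm 2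
p. 259, (0.20) p. 256, p. 264.
-/

noncomputable section

namespace Summit.QuantumFields.BalabanUV.T4Continuum.Spine.NE4

open Literature.MathematicalPhysics.QuantumFieldTheory.Balaban1983to89
open Literature.MathematicalPhysics.QuantumFieldTheory.Balaban1983to89.FlowStep
open Literature.MathematicalPhysics.QuantumFieldTheory.Balaban1983to89.T4CouplingMatching
open Literature.MathematicalPhysics.QuantumFieldTheory.Balaban1983to89.T4Continuum
open Literature.MathematicalPhysics.QuantumFieldTheory.Balaban1983to89.T4TwoRunUniqueness
  (TunedUniqueBelow tunedUniqueBelow_of_eventualLower)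
open Literature.MathematicalPhysics.QuantumFieldTheory.Balaban1983to89.T4ContinuumCoupling (ContinuumRunning)
open Literature.MathematicalPhysics.QuantumFieldTheory.Balaban1983to89.T4OutputRate (Carriers Functional NE5)
open Literature.MathematicalPhysics.QuantumFieldTheory.Balaban1983to89.T4BetaReadOut (Slice ReadOut RepresentsA RepresentsB)
open Literature.MathematicalPhysics.QuantumFieldTheory.Balaban1983to89.T4BetaReadOutLipschitz (ReadCovariantOn scaleShiftRate_of_ne5_on)
open Literature.MathematicalPhysics.QuantumFieldTheory.Balaban1983to89.T4FlagMemory (extd)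

universe u

/-! ## §1 The window is `O(γ)`: an explicit admissible run box -/

/-- **THE TWO-RADII WINDOW HOLDS ON SMALL RUN BOXES.**  For `C₁ ≥ 0`, `b > 0`, `W > 0` and
`γ ≤ min(1, W ∕ ((C₁+1)·((k₀+1) + 2∕b)))`, `γ ≥ 0`: `C₁·((k₀+1)γ³ + 2γ∕b) ≤ W` (use `γ³ ≤ γ` on `[0,1]`). [folklore] -/
theorem window_of_small_box {C₁ b W γ : ℝ} {k₀ : ℕ} (hC : 0 ≤ C₁) (hb : 0 < b) (hW : 0 < W) (hγ0 : 0 ≤ γ) (hγ1 : γ ≤ 1)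
    (hγW : γ ≤ W / ((C₁ + 1) * (((k₀ : ℝ) + 1) + 2 / b))) :
    C₁ * (((k₀ : ℝ) + 1) * γ ^ 3 + 2 * γ / b) ≤ W := by
  have hA : 0 < ((k₀ : ℝ) + 1) + 2 / b := by positivity
  have hden : 0 < (C₁ + 1) * (((k₀ : ℝ) + 1) + 2 / b) := by positivity
  have hγ3 : γ ^ 3 ≤ γ := by
    calc γ ^ 3 = γ * (γ * γ) := by ring
      _ ≤ γ * (1 * 1) := mul_le_mul_of_nonneg_left (mul_le_mul hγ1 hγ1 hγ0 zero_le_one) hγ0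
      _ = γ := by ring
  have h1 : ((k₀ : ℝ) + 1) * γ ^ 3 + 2 * γ / b ≤ (((k₀ : ℝ) + 1) + 2 / b) * γ := by
    have := mul_le_mul_of_nonneg_left hγ3 (by positivity : 0 ≤ (k₀ : ℝ) + 1)
    have e : (((k₀ : ℝ) + 1) + 2 / b) * γ = ((k₀ : ℝ) + 1) * γ + 2 * γ / b := by ring
    linarith
  have h2 : (((k₀ : ℝ) + 1) + 2 / b) * γ ≤ W / (C₁ + 1) := by
    calc (((k₀ : ℝ) + 1) + 2 / b) * γ ≤ (((k₀ : ℝ) + 1) + 2 / b) * (W / ((C₁ + 1) * (((k₀ : ℝ) + 1) + 2 / b))) :=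
          mul_le_mul_of_nonneg_left hγW hA.le
      _ = W / (C₁ + 1) := by field_simp
  calc C₁ * (((k₀ : ℝ) + 1) * γ ^ 3 + 2 * γ / b) ≤ C₁ * (W / (C₁ + 1)) :=
        mul_le_mul_of_nonneg_left (h1.trans h2) hC
    _ ≤ (C₁ + 1) * (W / (C₁ + 1)) := mul_le_mul_of_nonneg_right (by linarith) (by positivity)
    _ = W := by field_simp

variable {F : T4Family} {G : Type u} [GaugeGroup G] [MeasurableSpace G] [HaarData G]

/-- `γ²β′ < 1` restricts from `γᵤ` to `γ ≤ γᵤ` (`γ > 0`), whatever the sign of `β′`. [folklore] -/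
theorem sq_mul_lt_one_mono {γ γu β' : ℝ} (hγ : 0 < γ) (hγle : γ ≤ γu) (hγβ : γu ^ 2 * β' < 1) : γ ^ 2 * β' < 1 := by
  rcases le_or_gt β' 0 with hβ | hβ
  · exact lt_of_le_of_lt (mul_nonpos_of_nonneg_of_nonpos (sq_nonneg γ) hβ) one_pos
  · exact lt_of_le_of_lt (mul_le_mul_of_nonneg_right (pow_le_pow_left₀ hγ.le hγle 2) hβ.le) hγβ

/-! ## §2 Node U2's output under the targets' prefix, from NE4 + regularity, NO window binder -/

/-- **NODE U2's OUTPUT UNDER THE TARGETS' QUANTIFIER PREFIX, FROM NE4 + REGULARITY — NO FADING BINDER, NO WINDOW BINDER.**  With NE4 for the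
data (`NE4OnData D c θ γᵤ`, `c ≥ 0`, `0 < θ < 1`), the uniform bound `|D.βfun| ≤ B` and the C^{1,1} bound `CoordDerivLipschitz M γᵤ D.βfun` on
the boxes `]0,γᵤ]`, the AF binders there (`EventualLowerH b γᵤ k₀`, `b > 0`; the printed-type `BetaUpperH β′ γᵤ`, `γᵤ²β′ < 1`) and any rate
`τ ∈ ]0,1[` with `θ ≤ τ²`: for EVERY `γ ≤ γ₀ := min(γᵤ, 1, ((1−τ)∕2)∕((C₁+1)((k₀+1)+2∕b)))`, every `g` and every sequence `g₀` tuned to `g` within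
`]0,γ]`, `U2Output D g₀ (2c∕(1−τ)) τ` — i.e. `D.UnderHypotheses Hβ (fun g₀ ↦ U2Output D g₀ (2c∕(1−τ)) τ)` (threshold `γ₀`; `g₁ := 1` idle; (B) and `Hβ`
unused).  `u2Output_of_smooth` + `window_of_small_box`. [folklore] -/
theorem u2Output_under_of_smooth (D : FiniteEpsData F G) {Hβ : Prop} {c θ γu B M τ b β' : ℝ} {k₀ : ℕ}
    (hN : NE4OnData D c θ γu) (hc : 0 ≤ c) (hθ0 : 0 < θ) (hθ1 : θ < 1)
    (hB : ∀ k (v : Fin (k + 1) → ℝ), v ∈ Box γu k → |D.βfun k v| ≤ B) (hD : CoordDerivLipschitz M γu D.βfun) (hM : 0 ≤ M)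
    (hγu : 0 < γu) (hτ0 : 0 < τ) (hτ1 : τ < 1) (hθτ : θ ≤ τ ^ 2) (hb : 0 < b) (hlo : EventualLowerH b γu k₀ D.βfun)
    (hhi : BetaUpperH β' γu D.βfun) (hγβ : γu ^ 2 * β' < 1) :
    D.UnderHypotheses Hβ fun g₀ => U2Output D g₀ (2 * c / (1 - τ)) τ := by
  intro _ _
  set C₁ : ℝ := fadingConst c θ γu B M with hC₁
  have hC : 0 ≤ C₁ := fadingConst_nonneg hc hθ0 hθ1 hγu hM
  have hW : 0 < (1 - τ) / 2 := by linarith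
  set γ₀ : ℝ := min γu (min 1 ((1 - τ) / 2 / ((C₁ + 1) * (((k₀ : ℝ) + 1) + 2 / b)))) with hγ₀
  have hγ₀pos : 0 < γ₀ := lt_min hγu (lt_min one_pos (by positivity))
  refine ⟨γ₀, hγ₀pos, fun γ hγ hγle => ⟨1, one_pos, fun g _ _ g₀ ht => ?_⟩⟩
  have hγu' : γ ≤ γu := hγle.trans (min_le_left _ _)
  have hγ1 : γ ≤ 1 := hγle.trans ((min_le_right _ _).trans (min_le_left _ _))
  have hγW : γ ≤ (1 - τ) / 2 / ((C₁ + 1) * (((k₀ : ℝ) + 1) + 2 / b)) :=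
    hγle.trans ((min_le_right _ _).trans (min_le_right _ _))
  have hsmall := window_of_small_box (k₀ := k₀) hC hb hW hγ.le hγ1 hγW
  exact u2Output_of_smooth D hN hc hθ0 hθ1 hB hD hM hγu hγ hγu' hτ0 hτ1 hθτ hb
    (fun k v hk hv => hlo k v hk (box_mono hγu' k hv)) (fun k v hv => hhi k v (box_mono hγu' k hv))
    (sq_mul_lt_one_mono hγ hγu' hγβ) ht hsmall

/-- **THE CONTINUUM RUNNING COUPLING FROM NE4 + REGULARITY, under the same prefix** (`Targets.continuumRunning_of_u2Output` after
`u2Output_under_of_smooth`'s choice of the run box): for every `γ ≤ γ₀`, every `g`, every sequence tuned to `g` within `]0,γ]`,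
`ContinuumRunning D.βfun (runFlow D g₀) g γ b`. [folklore] -/
theorem continuumRunning_under_of_smooth (D : FiniteEpsData F G) {Hβ : Prop} {c θ γu B M τ b β' : ℝ} {k₀ : ℕ}
    (hN : NE4OnData D c θ γu) (hc : 0 ≤ c) (hθ0 : 0 < θ) (hθ1 : θ < 1)
    (hB : ∀ k (v : Fin (k + 1) → ℝ), v ∈ Box γu k → |D.βfun k v| ≤ B) (hD : CoordDerivLipschitz M γu D.βfun) (hM : 0 ≤ M)
    (hγu : 0 < γu) (hτ0 : 0 < τ) (hτ1 : τ < 1) (hθτ : θ ≤ τ ^ 2) (hb : 0 < b) (hlo : EventualLowerH b γu k₀ D.βfun)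
    (hhi : BetaUpperH β' γu D.βfun) (hγβ : γu ^ 2 * β' < 1) :
    D.UnderHypotheses Hβ fun g₀ => ∃ γ g : ℝ, ContinuumRunning D.βfun (runFlow D g₀) g γ b := by
  intro hBst hH
  obtain ⟨γ₀, hγ₀, hall⟩ := u2Output_under_of_smooth D (Hβ := Hβ) hN hc hθ0 hθ1 hB hD hM hγu hτ0 hτ1 hθτ hb hlo hhi hγβ hBst hH
  refine ⟨min γ₀ γu, lt_min hγ₀ hγu, fun γ hγ hγle => ?_⟩
  obtain ⟨g₁, hg₁, hg⟩ := hall γ hγ (hγle.trans (min_le_left _ _))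
  refine ⟨g₁, hg₁, fun g hg0 hgle g₀ ht => ⟨γ, g, ?_⟩⟩
  have hγu' : γ ≤ γu := hγle.trans (min_le_right _ _)
  exact continuumRunning_of_u2Output D (hg g hg0 hgle g₀ ht) hτ1 hγ (fun k v hv => hhi k v (box_mono hγu' k hv))
    (sq_mul_lt_one_mono hγ hγu' hγβ) ht (fun k v hk hv => hlo k v hk (box_mono hγu' k hv)) hb.le

/-- **TUNED UNIQUENESS ON A SMALL BOX FROM NE4 + REGULARITY** (`Targets.tunedUniqueBelow_of_u2Inputs` with the derived moduli): the β-side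
hypotheses on `]0,γᵤ]`, the AF binders on `]0,γ]`, `γ ≤ γᵤ`, and the strict window `C₁(γᵤ)·((k₀+1)γ³ + 2γ∕b) < 1 − τ` make [Balaban1987RG1]
Thm 2's tuned bare coupling unique below `γ` (`TunedUniqueBelow D γ`).  NE4 proper enters only through the derived moduli. [folklore] -/
theorem tunedUniqueBelow_of_smooth (D : FiniteEpsData F G) {c θ γ γu B M τ b β' : ℝ} {k₀ : ℕ} (hN : NE4OnData D c θ γu)
    (hc : 0 ≤ c) (hθ0 : 0 < θ) (hθ1 : θ < 1) (hB : ∀ k (v : Fin (k + 1) → ℝ), v ∈ Box γu k → |D.βfun k v| ≤ B)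
    (hD : CoordDerivLipschitz M γu D.βfun) (hM : 0 ≤ M) (hγu : 0 < γu) (hγle : γ ≤ γu) (hτ0 : 0 < τ) (hτ1 : τ < 1)
    (hθτ : θ ≤ τ ^ 2) (hb : 0 < b) (hlo : EventualLowerH b γ k₀ D.βfun) (hhi : BetaUpperH β' γ D.βfun) (hγβ : γ ^ 2 * β' < 1)
    (hsmall : fadingConst c θ γu B M * (((k₀ : ℝ) + 1) * γ ^ 3 + 2 * γ / b) < 1 - τ) : TunedUniqueBelow D γ :=
  tunedUniqueBelow_of_u2Inputs D ((u2Inputs_of_smooth D hN hc hθ0 hθ1 hB hD hM hγu hτ0 hτ1.le hθτ).mono hγle) hτ0.le hτ1 hb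
    hlo hhi hγβ hsmall

/-! ## §3 Upstream: node U2's triple from NE5 + the read-out (R) + regularity of β — node U3's NE9 and its fading NOT used -/

/-- **NODE U2's TRIPLE ON THE DATA FROM NE5 + (R) + REGULARITY — NO NE9, NO U3 FADING MEMORY.**  Compare `Targets.u2Inputs_of_u3` (NE5 ∧ NE9 ∧
`T4OutputRate.FadingMemory` ∧ (R) ⇒ the triple): here the η-rate of β comes from NE5 for every unpaired coupling `b` and the covariant read-out
(`T4BetaReadOutLipschitz.scaleShiftRate_of_ne5_on`, BY NAME), and BOTH history companions — the moduli AND their decay — come from the C^{1,1}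
bound `CoordDerivLipschitz M γᵤ D.βfun` and the uniform bound `|D.βfun| ≤ B` by `histLipschitz_fadingMemory_of_smooth`.  So row NE4's node-U2
triple depends on row NE5, the read-out (R) and a regularity clause of printed TYPE on the β-functions; row NE9 (`T4OutputRate.NE9`, joint Lipschitz
moduli of `E^{(j)}`, and their `FadingMemory`) is NOT an input of node U2 (it remains one of node U5b's three brackets).  Every input UNPRINTED
(NE5: GAPS G-t4-U3-1; (R): dischargeable on analytic slices; regularity for `i < k`: G-t4-U2-2). [folklore] -/
theorem u2Inputs_of_ne5_smooth (D : FiniteEpsData F G) {C : Carriers} {W : Set (ℕ → ℝ)} {EA : Functional C C.BgA}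
    {EB : ℝ → Functional C C.BgB} {𝒜A : Set (Slice C C.BgA)} {𝒜B : Set (Slice C C.BgB)} {rA : ReadOut C C.BgA}
    {rB : ReadOut C C.BgB} {γu κ θ C₅ cr B M τ : ℝ}
    (hW : ∀ k (v : Fin (k + 1) → ℝ), v ∈ Box γu k → extd v ∈ W) (h5 : ∀ b, 0 < b → b ≤ γu → NE5 EA (EB b) W κ θ C₅)
    (hA : RepresentsA EA rA γu D.βfun) (hB : RepresentsB EB rB γu D.βfun) (h𝒜A : ∀ g ∈ W, EA g ∈ 𝒜A)
    (h𝒜B : ∀ b, 0 < b → b ≤ γu → ∀ g ∈ W, EB b g ∈ 𝒜B) (hcov : ReadCovariantOn 𝒜A 𝒜B rA rB κ cr) (hcr : 0 ≤ cr) (hC₅ : 0 ≤ C₅)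
    (hθ0 : 0 < θ) (hθ1 : θ < 1) (hBd : ∀ k (v : Fin (k + 1) → ℝ), v ∈ Box γu k → |D.βfun k v| ≤ B)
    (hD : CoordDerivLipschitz M γu D.βfun) (hM : 0 ≤ M) (hγu : 0 < γu) (hτ0 : 0 < τ) (hτ1 : τ ≤ 1) (hθτ : θ ≤ τ ^ 2) :
    U2Inputs D (cr * C₅ * θ) (fadingConst (cr * C₅ * θ) θ γu B M) τ γu
      (fun k i => fadingConst (cr * C₅ * θ) θ γu B M * τ ^ (k - i)) :=
  u2Inputs_of_smooth D (scaleShiftRate_of_ne5_on hW h5 hA hB h𝒜A h𝒜B hcov) (mul_nonneg (mul_nonneg hcr hC₅) hθ0.le) hθ0 hθ1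
    hBd hD hM hγu hτ0 hτ1 hθτ

end Summit.QuantumFields.BalabanUV.T4Continuum.Spine.NE4

end
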